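import Mathlib
import Summits.ValiantsHypothesis.ValiantsHypothesis.Theorems.LacunarySymmetroidMatrixDescartesCensusDefs
import Summits.ValiantsHypothesis.ValiantsHypothesis.Theorems.LacunarySymmetroidMatrixDescartesStubDescartesCeiling
import Summits.ValiantsHypothesis.ValiantsHypothesis.Theorems.TowerDoorS5Conjecture

/-!
# Tower graft line — EVERY FIXED-LETTER TRUNCATION OF THE GRAFT LAW S5 IS A DESCARTES THEOREM (the door's content is uniformity in `K`)

Calibration file for the line `Cruxes/WeakLifting/Lines/tower_graft.lean` (crux `WeakLifting` = stmt-ValiantsHypothesis-19561) and the door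
`Theorems/TowerDoorS5Conjecture.lean` (`TowerGraftLaw` = S5, stmt-ValiantsHypothesis-23803: `∃ C, ∀ m K B D d, IsTower → far → PosRootLawOn m K B d →
PosRootLawOn m (K+1) (2^C·B + 2^{C·log₂² m}) (Fin.snoc d D)`).  NO stub is claimed and S5 is NOT proved: this file proves the statement with the
quantifiers `∃ C ∀ K` WEAKENED to `∀ K₀ ∃ C ∀ K ≤ K₀` — a PARTIAL-RANGE theorem, stated honestly as such.

* `choose_succ_letters_le_two_pow` — the arithmetic: for `m ≥ 2` and `K ≤ K₀`, `C(m+K, m) ≤ 2^{K₀(K₀+2)·(log₂ m)²}`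
  (`C(m+K,m) ≤ (m+K)^K ≤ 2^{(log₂ m + 1 + K₀)K₀}` and `log₂ m ≥ 1`).
* `one_le_of_posRootLawOn_one` — at size `1` with two distinct exponents the class budget is at least `1` (`X^{d₀} − X^{d₁}` vanishes at `1`).
* ★ `towerGraftLaw_bounded_letters (K₀)` — **`∃ C (= K₀(K₀+2)), ∀ m K B D d, K ≤ K₀ → IsTower m d → (∀ l, m·d l < D) → PosRootLawOn m K B d →
  PosRootLawOn m (K+1) (2^C·B + 2^{C·(log₂ m)²}) (Fin.snoc d D)`** — the body of `TowerGraftLaw` with the letter count capped.  Proof: the sparse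
  Descartes ceiling `stub_descartesCeiling` (`Z₊ + 1 ≤ C(m+K, m)` for the grafted `(K+1)`-letter pencil, no symmetry, no tower needed) and the
  arithmetic; at `m = 1` the factor term `2^C·B ≥ K₀` pays (`B ≥ 1`), at `m ≥ 2` the additive term `2^{C log₂² m}` alone pays, at `m = 0` nothing to
  pay.  The tower hypothesis is used only at `m = 1` (distinct exponents); the far-exponent hypothesis not at all; the hypothesis-free Descartes
  form is `posRootLawOn_snoc_descartes`.

READING.  S5 quantifies ONE `C` for ALL `K`; every truncation `K ≤ K₀` is Descartes-zone with `C = K₀(K₀+2)` — so the research content of the door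
is exactly the UNIFORMITY IN `K` (the window `log₂² m ≲ K ≲ m`), in the kernel and by name on S5's binder shape.  Nothing here bears on that
content.  HONEST FRAMING: Descartes bookkeeping; S5/S5ᴸ/S4/S4b, TowerB, `WeakLifting`, Conjecture B, `MatrixDescartes` (18050) untouched; VP ≠ VNP
NOT proved.  Def-free.  Seat: prover val-sym-lift-p2 g21, `--supports stmt-ValiantsHypothesis-19561`.
-/

-- `Summit.ValiantsHypothesis.ValiantsHypothesis.…` repeats a component by the D-0017 layout
-- (single-conjunct summit), which the `dupNamespace` linter flags; the name is mandated.
set_option linter.dupNamespace false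

namespace Summit.ValiantsHypothesis.ValiantsHypothesis.Theorems.KPlusLogSqLaw.TowerGraft

open Polynomial Matrix
open scoped BigOperators Polynomial
open Summit.ValiantsHypothesis.ValiantsHypothesis.Theorems.LacunarySymmetroidMatrixDescartes (PosRootLawOn stub_descartesCeiling)

section BoundedLetters

/-- **the arithmetic of the Descartes zone**: `m ≥ 2`, `K ≤ K₀` ⇒ `C(m+K, m) ≤ 2^{K₀(K₀+2)·(log₂ m)²}`. [this work] -/
theorem choose_succ_letters_le_two_pow {m K K₀ : ℕ} (hm : 2 ≤ m) (hK : K ≤ K₀) :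
    Nat.choose (m + K) m ≤ 2 ^ (K₀ * (K₀ + 2) * Nat.log 2 m ^ 2) := by
  set L := Nat.log 2 m with hL
  have hL1 : 1 ≤ L := by
    rw [hL]
    exact Nat.le_log_of_pow_le (by norm_num) (by simpa using hm)
  have hmlt : m < 2 ^ (L + 1) := Nat.lt_pow_succ_log_self (by norm_num) m
  have hK₀lt : K₀ < 2 ^ K₀ := Nat.lt_two_pow_self
  -- `C(m+K, m) = C(m+K, K) ≤ (m+K)^K ≤ (m+K₀)^K₀`
  have h1 : Nat.choose (m + K) m = Nat.choose (m + K) K := by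
    rw [Nat.choose_symm_add]
  have h2 : Nat.choose (m + K) K ≤ (m + K) ^ K := Nat.choose_le_pow _ _
  have h3 : (m + K) ^ K ≤ (m + K₀) ^ K₀ := by
    calc (m + K) ^ K ≤ (m + K₀) ^ K := Nat.pow_le_pow_left (by omega) K
      _ ≤ (m + K₀) ^ K₀ := Nat.pow_le_pow_right (by omega) hK
  -- `m + K₀ ≤ 2^{L+1+K₀}`
  have h4 : m + K₀ ≤ 2 ^ (L + 1 + K₀) := by
    have e : 2 ^ (L + 1 + K₀) = 2 ^ (L + 1) * 2 ^ K₀ := by rw [pow_add]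
    rw [e]
    have ha : 1 ≤ 2 ^ (L + 1) := Nat.one_le_two_pow
    have hb : 1 ≤ 2 ^ K₀ := Nat.one_le_two_pow
    nlinarith
  have h5 : (m + K₀) ^ K₀ ≤ (2 ^ (L + 1 + K₀)) ^ K₀ := Nat.pow_le_pow_left h4 K₀
  have h6 : (2 ^ (L + 1 + K₀)) ^ K₀ = 2 ^ ((L + 1 + K₀) * K₀) := by rw [← pow_mul]
  -- exponent comparison `(L+1+K₀)·K₀ ≤ K₀(K₀+2)·L²` for `L ≥ 1`
  have h7 : (L + 1 + K₀) * K₀ ≤ K₀ * (K₀ + 2) * L ^ 2 := by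
    have hLK : L + 1 + K₀ ≤ (K₀ + 2) * L := by nlinarith
    have hLL : L ≤ L ^ 2 := by nlinarith
    calc (L + 1 + K₀) * K₀ ≤ (K₀ + 2) * L * K₀ := Nat.mul_le_mul_right _ hLK
      _ = K₀ * (K₀ + 2) * L := by ring
      _ ≤ K₀ * (K₀ + 2) * L ^ 2 := Nat.mul_le_mul_left _ hLL
  calc Nat.choose (m + K) m = Nat.choose (m + K) K := h1
    _ ≤ (m + K) ^ K := h2
    _ ≤ (m + K₀) ^ K₀ := h3
    _ ≤ (2 ^ (L + 1 + K₀)) ^ K₀ := h5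
    _ = 2 ^ ((L + 1 + K₀) * K₀) := h6
    _ ≤ 2 ^ (K₀ * (K₀ + 2) * L ^ 2) := Nat.pow_le_pow_right (by norm_num) h7

/-- **HYPOTHESIS-FREE DESCARTES FORM**: for ANY support and ANY far exponent, the grafted `(K+1)`-letter pencil of size `m` has at most
`C(m+K, m) − 1` positive determinant roots (`stub_descartesCeiling`). [folklore] -/
theorem posRootLawOn_snoc_descartes (m K D : ℕ) (d : Fin K → ℕ) :
    PosRootLawOn m (K + 1) (Nat.choose (m + K) m - 1) (Fin.snoc d D) := by
  intro S _
  have h := stub_descartesCeiling (K + 1) m (Nat.succ_pos K) (Fin.snoc d D) S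
  rw [show m + (K + 1) - 1 = m + K by omega] at h
  omega

/-- at size `1`, two letters with distinct exponents already force one positive root (`X^{d₀} − X^{d₁}` vanishes at `1`): the class budget of a
`K ≥ 2`-letter `1`-tower is at least `1`. [folklore] -/
theorem one_le_of_posRootLawOn_one {K B : ℕ} (d : Fin K → ℕ) (l₀ l₁ : Fin K) (hd : d l₀ ≠ d l₁) (hB : PosRootLawOn 1 K B d) : 1 ≤ B := by
  classical
  -- the pencil `X^{d l₀}·1 − X^{d l₁}·1`
  have hl : l₀ ≠ l₁ := fun h => hd (by rw [h])
  set S : Fin K → Matrix (Fin 1) (Fin 1) ℝ := fun l => if l = l₀ then 1 else if l = l₁ then -1 else 0 with hS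
  have hSsymm : ∀ l, (S l).IsSymm := by
    intro l
    simp only [hS]
    split_ifs
    · exact Matrix.isSymm_one
    · exact Matrix.isSymm_one.neg
    · exact Matrix.isSymm_zero
  have h := hB S hSsymm
  have hdet : (∑ l, (X : ℝ[X]) ^ d l • (S l).map C).det = X ^ d l₀ - X ^ d l₁ := by
    rw [Matrix.det_fin_one, Matrix.sum_apply]
    have e : ∀ l, ((X : ℝ[X]) ^ d l • (S l).map C) 0 0 = if l = l₀ then X ^ d l₀ else if l = l₁ then -X ^ d l₁ else 0 := by
      intro l
      simp only [hS, Matrix.smul_apply, Matrix.map_apply, smul_eq_mul]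
      split_ifs with h1 h2
      · subst h1; simp
      · subst h2; simp
      · simp
    simp_rw [e]
    rw [Finset.sum_eq_add l₀ l₁ hl (fun c _ hc => by rw [if_neg hc.1, if_neg hc.2]) (fun h => absurd (Finset.mem_univ _) h)
      (fun h => absurd (Finset.mem_univ _) h)]
    rw [if_pos rfl, if_neg hl.symm, if_pos rfl]
    ring
  rw [hdet] at h
  have hne : (X : ℝ[X]) ^ d l₀ - X ^ d l₁ ≠ 0 := by
    intro h0
    have := congrArg (fun p : ℝ[X] => p.coeff (d l₀)) h0
    simp only [coeff_sub, coeff_X_pow, if_true, coeff_zero] at this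
    rw [if_neg hd] at this
    norm_num at this
  have hroot : (1 : ℝ) ∈ ((X : ℝ[X]) ^ d l₀ - X ^ d l₁).roots.toFinset.filter (fun t => 0 < t) := by
    rw [Finset.mem_filter, Multiset.mem_toFinset, Polynomial.mem_roots hne]
    exact ⟨by simp, one_pos⟩
  exact le_trans (Finset.one_le_card.mpr ⟨1, hroot⟩) h

/-- **EVERY FIXED-LETTER TRUNCATION OF S5 IS A DESCARTES THEOREM.**  For every `K₀` there is `C` (namely `K₀(K₀+2)`) such that the body of
`TowerGraftLaw` holds for all `m, B, D, d` and all `K ≤ K₀`: grafting one far letter on a `K`-letter tower costs at most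
`2^C·B + 2^{C·(log₂ m)²}`.  (S5 itself asks for ONE `C` for ALL `K` — the window `K ≫ log₂² m` — and is NOT proved here.) [this work] -/
theorem towerGraftLaw_bounded_letters (K₀ : ℕ) :
    ∃ C : ℕ, ∀ (m K B D : ℕ) (d : Fin K → ℕ), K ≤ K₀ → (∀ l l' : Fin K, l < l' → m * d l < d l') → (∀ l, m * d l < D) →
      PosRootLawOn m K B d → PosRootLawOn m (K + 1) (2 ^ C * B + 2 ^ (C * Nat.log 2 m ^ 2)) (Fin.snoc d D) := by
  refine ⟨K₀ * (K₀ + 2), fun m K B D d hK hd _ hB => ?_⟩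
  intro S hS
  have hdesc := posRootLawOn_snoc_descartes m K D d S hS
  -- three sizes: `m = 0`, `m = 1`, `m ≥ 2`
  rcases Nat.lt_or_ge m 2 with hm | hm
  · interval_cases m
    · -- `m = 0`: `C(K, 0) − 1 = 0`
      have : Nat.choose (0 + K) 0 - 1 = 0 := by simp
      rw [this] at hdesc
      exact hdesc.trans (Nat.zero_le _)
    · -- `m = 1`: `C(1+K, 1) − 1 = K ≤ 2^C·B + 1`
      have hZ : ((∑ l, (X : ℝ[X]) ^ (Fin.snoc d D : Fin (K + 1) → ℕ) l • (S l).map C).det.roots.toFinset.filter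
          (fun t => 0 < t)).card ≤ K := by
        have h' := hdesc
        rw [Nat.choose_one_right] at h'
        omega
      have hadd : 1 ≤ 2 ^ (K₀ * (K₀ + 2) * Nat.log 2 1 ^ 2) := Nat.one_le_two_pow
      rcases Nat.lt_or_ge K 2 with hK2 | hK2
      · omega
      · -- two letters with distinct exponents (`1·d 0 < d 1`): `B ≥ 1`, and `K ≤ K₀ ≤ 2^C`
        have h01 : d ⟨0, by omega⟩ ≠ d ⟨1, by omega⟩ := by
          have := hd ⟨0, by omega⟩ ⟨1, by omega⟩ (Fin.mk_lt_mk.mpr zero_lt_one)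
          omega
        have hB1 := one_le_of_posRootLawOn_one d _ _ h01 hB
        have hC : K₀ ≤ 2 ^ (K₀ * (K₀ + 2)) := by
          calc K₀ ≤ 2 ^ K₀ := Nat.lt_two_pow_self.le
            _ ≤ 2 ^ (K₀ * (K₀ + 2)) := Nat.pow_le_pow_right (by norm_num) (by nlinarith)
        have hCB : K₀ ≤ 2 ^ (K₀ * (K₀ + 2)) * B := hC.trans (Nat.le_mul_of_pos_right _ hB1)
        omega
  · -- `m ≥ 2`: the additive term alone pays
    have h := choose_succ_letters_le_two_pow (K₀ := K₀) hm hK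
    omega

end BoundedLetters

end Summit.ValiantsHypothesis.ValiantsHypothesis.Theorems.KPlusLogSqLaw.TowerGraft
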